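import Literature.MathematicalPhysics.QuantumFieldTheory.Balaban1983to89.T4AxialGaugeSmallField
import Literature.MathematicalPhysics.QuantumFieldTheory.Balaban1983to89.B11GaugeGlue
import Literature.MathematicalPhysics.QuantumFieldTheory.Balaban1983to89.B15PrelimIntegrations
import HarnessLib

/-!
# `UnitScaleTiltLadderHolonomyModulus` — TWO-FIELD COMPARISON OF LADDER HOLONOMIES: the holonomy of the non-abelian Stokes ladder over a word `w` changes, between two
# bond fields `V`, `W` on `ℤ^d`, by at most `|w|·(2a + p)` where `a` bounds the rail steps' discrepancies `dist1 (V-step · W-step⁻¹)` and `p` the elementary-loop discrepancies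
# along `w`; specialised to `W = V(· + s)` it is the TRANSLATION MODULUS of a ladder holonomy — hence of an axial-gauge bond variable — in terms of the translation modulus
# of the CURVATURE (route `UnitScaleTilt`, crux K1′ `MinimiserStabilityRegPr` stmt-QuantumFields-19200, (L3′b)-GRAD row (★) «η-scale modulus of the axial-gauge representative»,
# piece R1 = the reduction «bond modulus ⟸ plaquette-field modulus»; opened by ★★OWNER RULING №35-B, split by ★p1 g25 CHAIR WORD №4: R1 + torus transfer ← px19,
# R2 = ∅ (★p1 g13's ✓`UnitScaleTiltCurvGradAxialBianchi` ∕ ✓`UnitScaleTiltCurvGradAxialFlat`, cited by name), R3′ = curvature ½-Hölder modulus ← w5 g14)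

Cell `ym3-torus` (YM ladder rung R3 = continuum SU(2) Yang–Mills on T³ — a RUNG, NOT the Clay problem: not d = 4, not infinite volume, not a mass gap);
width seat `ym3-torus-px19` (gen 12); helper `--supports stmt-QuantumFields-19200`.  THEOREMS ONLY (0 `def`, 0 `sorry`, default heartbeats), ANY `[GaugeGroup G]`, any `d`,
on the `ℤ^d` word carrier of lit ✓`B7Prop1Explicit` (`hol`, `stepHol`, `ladder`, `lplaqWord`, `hol_ladder_cons`) — the carrier of lit ✓`T4AxialGaugeSmallField` §1 and ✓`B8Lemma1NonAbelian`.

WHY (the reduction agreed on the bus, px19 04:49:44Z ∕ w5 04:50:19Z).  In the complete axial gauge a non-tree bond is (a conjugate of) the holonomy of a LADDER of `h ≤ (d−1)·4K`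
elementary loops (lit ✓`B8Lemma1NonAbelian.axial_bond_eq_sharp`); the rails are tree bonds.  Comparing the SAME ladder word read in two fields letter by letter
(✓`hol_ladder_cons`: `V(ladder (l :: w)) = (g·V(ladder w)·g⁻¹)·V(∂p_l)`) gives §2 ★★`dist1_hol_ladder_mul_inv_le`: `dist1 (V(ladder w)·W(ladder w)⁻¹) ≤ |w|·(2a + p)` whenever every
rail step met along `w` has `dist1 (V-step·W-step⁻¹) ≤ a` and every elementary loop met has `dist1 (V(∂p)·W(∂p)⁻¹) ≤ p`.  With `W := V(· + s)` (§3 `hol_translate`,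
★★★`dist1_hol_ladder_translate_le`): the translation difference of a ladder holonomy is `≤ |w|·(2a + p)` with `a` = the translation modulus of the RAIL bonds (ZERO on the tree of an
axial gauge) and `p` = the translation modulus of the gauged PLAQUETTE variables met along the ladder — so the (★) row, in its ½-HÖLDER currency
`‖V(b) − V(b′)‖ ≤ C·ε₀·η·(tdist·η)^{½}` (w5 g14 ERRATUM 04:55:18Z, CHAIR WORD №4), is EXACTLY `h·p ≤ 4(d−1)K·p` with `p = ω_F(tdist) ≲ ε₀η²·(tdist·η)^{½}` the K-UNIFORM ½-HÖLDER
MODULUS OF THE CURVATURE at scale η (piece R3′: lit ✓`B4Eq19LatticeInteriorHolder.exists_interior_holder_const` on the flat div–curl data of ✓`UnitScaleTiltCurvGradAxialFlat`, from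
`PlaqSmall ∧ DivSmall`; not here — `p` is currency-agnostic, this file serves either road).

* §1 distance algebra for `d(x,y) := dist1 (x·y⁻¹)`: ★`dist1_conj_mul_inv_conj_le` (`d(gAg⁻¹, hBh⁻¹) ≤ d(A,B) + 2·d(g,h)`; the two-factor telescoping is inlined);
* §2 ★★`dist1_hol_ladder_mul_inv_le` (induction on `w` over ✓`hol_ladder_cons`, hypotheses only on the letters MET along `w`);
* §3 `hol_translate` (`hol (V(· + s)) x w = hol V (x + s) w`), ★★★`dist1_hol_ladder_translate_le`.

HONEST SCOPE.  Word algebra; nothing of (★), GRAD, `hT`, `hGF`, EX, `MinimiserStabilityRegPr` (19200) or the rung `YM3TorusSU2` is proved; no summit statement is proved; the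
Yang–Mills mass gap is NOT proved.  Opened by ★★OWNER RULING №35-B (2026-08-30 04:57Z) and ★p1 g25 CHAIR WORD №4; the torus transfer ∕ member row (both `RegPr` clauses
`PlaqSmall` AND `DivSmall` visible, explicit no-wrap antecedent `2(R+1) ≤ sitesPerDir 0`) is the NEXT file, on R3′'s olean.
References: [Balaban1985Averaging] (9) p. 18, (44)–(45) p. 24, (46) p. 25 (ladders, the non-abelian Stokes estimate); [Balaban1985RegularSpaces] (1.7)–(1.9) p. 77, Lemma 1 p. 79.
-/

set_option autoImplicit false

open Literature.MathematicalPhysics.QuantumFieldTheory.Balaban1983to89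
open Literature.MathematicalPhysics.QuantumFieldTheory.Balaban1983to89.B7Prop1Explicit (Site Letter e disp disp_nil disp_cons disp_append hol hol_nil hol_cons stepHol
  ladder lplaqWord hol_ladder_cons)
open Literature.MathematicalPhysics.QuantumFieldTheory.Balaban1983to89.B11GaugeGlue (dist1_inv_mul_eq)
open Literature.MathematicalPhysics.QuantumFieldTheory.Balaban1983to89.B15.PrelimIntegrations (dist1_fluct_le)

namespace Summit.QuantumFields.YangMills.Theorems.LadderHolonomyModulus

variable {d : ℕ} {G : Type*} [GaugeGroup G]

/-! ## §1 Distance algebra for `d(x, y) := dist1 (x·y⁻¹)` -/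

/-! The two-factor telescoping `d(a₁a₂, b₁b₂) ≤ d(a₁, b₁) + d(a₂, b₂)` is ✓`Balaban3D.Proofs.FibreClashWitness.dist1_mul_mul_inv_le` in the tree; it is re-derived
inline below (three lines) to keep this file's imports inside the `UnitScaleTilt` lane. -/

/-- ★ **CONJUGATES BY NEARBY ELEMENTS OF NEARBY ELEMENTS ARE NEARBY**: `d(gAg⁻¹, hBh⁻¹) ≤ d(A, B) + 2·d(g, h)`
(`gAg⁻¹(hBh⁻¹)⁻¹ ∼ (AB⁻¹)·(B u B⁻¹ u⁻¹)`, `u = g⁻¹h`, and `dist1 (BuB⁻¹u⁻¹) ≤ 2·dist1 u`). [cite: Balaban1985Averaging, (19) p.21] -/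
theorem dist1_conj_mul_inv_conj_le (g h A B : G) :
    dist1 (g * A * g⁻¹ * (h * B * h⁻¹)⁻¹) ≤ dist1 (A * B⁻¹) + 2 * dist1 (g * h⁻¹) := by
  have e1 : g * A * g⁻¹ * (h * B * h⁻¹)⁻¹ = g * ((A * B⁻¹) * (B * (g⁻¹ * h) * B⁻¹ * (g⁻¹ * h)⁻¹)) * g⁻¹ := by group
  rw [e1, GaugeGroup.dist1_conj]
  refine (GaugeGroup.dist1_mul_le _ _).trans ?_
  have h2 : dist1 (B * (g⁻¹ * h) * B⁻¹ * (g⁻¹ * h)⁻¹) ≤ 2 * dist1 (g * h⁻¹) := by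
    refine (GaugeGroup.dist1_mul_le _ _).trans ?_
    rw [GaugeGroup.dist1_conj, GaugeGroup.dist1_inv, dist1_inv_mul_eq]
    linarith
  linarith

/-! ## §2 The two-field ladder comparison -/

/-- ★★ **TWO-FIELD LADDER COMPARISON.**  For bond fields `V, W : ℤ^d → Fin d → G`, a word `w` spelled from `x` and a direction `μ`: if every rail step met along `w` satisfies
`dist1 (stepHol V z l · (stepHol W z l)⁻¹) ≤ a` and every elementary loop met satisfies `dist1 (hol V z (lplaqWord l μ) · (hol W z (lplaqWord l μ))⁻¹) ≤ p` (`z = x + disp` of the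
prefix), then `dist1 (hol V x (ladder w μ) · (hol W x (ladder w μ))⁻¹) ≤ |w|·(2a + p)` (induction over ✓`hol_ladder_cons`). [cite: Balaban1985Averaging, (44)-(45) p.24, (46) p.25] -/
theorem dist1_hol_ladder_mul_inv_le (V W : Site d → Fin d → G) (μ : Fin d) {a p : ℝ} (ha : 0 ≤ a) (hp : 0 ≤ p) :
    ∀ (w : List (Letter d)) (x : Site d),
      (∀ (w₁ : List (Letter d)) (l : Letter d) (w₂ : List (Letter d)), w = w₁ ++ l :: w₂ →
        dist1 (stepHol V (x + disp w₁) l * (stepHol W (x + disp w₁) l)⁻¹) ≤ a) →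
      (∀ (w₁ : List (Letter d)) (l : Letter d) (w₂ : List (Letter d)), w = w₁ ++ l :: w₂ →
        dist1 (hol V (x + disp w₁) (lplaqWord l μ) * (hol W (x + disp w₁) (lplaqWord l μ))⁻¹) ≤ p) →
      dist1 (hol V x (ladder w μ) * (hol W x (ladder w μ))⁻¹) ≤ (w.length : ℝ) * (2 * a + p)
  | [], x, _, _ => by
    have hV : hol V x (ladder [] μ) = 1 := by
      simp [ladder, B7Prop1Explicit.revWord, hol, stepHol, B7Prop1Explicit.Letter.vec]
    have hW : hol W x (ladder [] μ) = 1 := by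
      simp [ladder, B7Prop1Explicit.revWord, hol, stepHol, B7Prop1Explicit.Letter.vec]
    rw [hV, hW, inv_one, mul_one, GaugeGroup.dist1_one]
    simp
  | l :: w, x, hstep, hplaq => by
    rw [hol_ladder_cons, hol_ladder_cons]
    -- the rail step and the elementary loop at `x` (prefix `[]`)
    have hs : dist1 (stepHol V x l * (stepHol W x l)⁻¹) ≤ a := by
      have := hstep [] l w rfl; simpa using this
    have hq : dist1 (hol V x (lplaqWord l μ) * (hol W x (lplaqWord l μ))⁻¹) ≤ p := by
      have := hplaq [] l w rfl; simpa using this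
    -- the inner ladder, spelled from `x + l.vec` (prefixes `l :: w₁`)
    have ih := dist1_hol_ladder_mul_inv_le V W μ ha hp w (x + l.vec)
      (fun w₁ l' w₂ hw => by
        have := hstep (l :: w₁) l' w₂ (by rw [hw]; rfl)
        simpa [disp_cons, add_assoc] using this)
      (fun w₁ l' w₂ hw => by
        have := hplaq (l :: w₁) l' w₂ (by rw [hw]; rfl)
        simpa [disp_cons, add_assoc] using this)
    -- two-factor telescoping `d(a₁a₂, b₁b₂) ≤ d(a₁, b₁) + d(a₂, b₂)`
    have tele : ∀ a₁ a₂ b₁ b₂ : G, dist1 (a₁ * a₂ * (b₁ * b₂)⁻¹) ≤ dist1 (a₁ * b₁⁻¹) + dist1 (a₂ * b₂⁻¹) := fun a₁ a₂ b₁ b₂ => by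
      have h : a₁ * a₂ * (b₁ * b₂)⁻¹ = b₁ * ((b₁⁻¹ * a₁) * (a₂ * b₂⁻¹)) * b₁⁻¹ := by group
      rw [h, GaugeGroup.dist1_conj]
      refine (GaugeGroup.dist1_mul_le _ _).trans ?_
      rw [dist1_inv_mul_eq, ← GaugeGroup.dist1_inv (b₁ * a₁⁻¹), mul_inv_rev, inv_inv]
    refine (tele _ _ _ _).trans ?_
    have hc := dist1_conj_mul_inv_conj_le (stepHol V x l) (stepHol W x l) (hol V (x + l.vec) (ladder w μ)) (hol W (x + l.vec) (ladder w μ))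
    simp only [List.length_cons, Nat.cast_succ]
    nlinarith [hc, ih, hs, hq]

/-! ## §3 Translation: `W = V(· + s)` -/

/-- The holonomy of the translated field is the translated holonomy: `hol (V(· + s)) x w = hol V (x + s) w`. [cite: Balaban1985Averaging, (9) p.18] -/
theorem hol_translate (V : Site d → Fin d → G) (s : Site d) :
    ∀ (w : List (Letter d)) (x : Site d), hol (fun z ν => V (z + s) ν) x w = hol V (x + s) w
  | [], x => by simp
  | l :: w, x => by
    rw [hol_cons, hol_cons, hol_translate V s w (x + l.vec), show x + l.vec + s = x + s + l.vec by abel]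
    congr 1
    simp only [stepHol]
    split_ifs <;> simp [add_right_comm]

/-- ★★★ **TRANSLATION MODULUS OF A LADDER HOLONOMY.**  If along the word `w` spelled from `x` every rail step has translation discrepancy
`dist1 (stepHol V z l · (stepHol V (z + s) l)⁻¹) ≤ a` and every elementary loop has `dist1 (V(∂p_z) · V(∂p_{z+s})⁻¹) ≤ p` (gauged plaquette variables read through `hol … (lplaqWord l μ)`),
then `dist1 (hol V x (ladder w μ) · (hol V (x + s) (ladder w μ))⁻¹) ≤ |w|·(2a + p)`.  In the axial gauge the rails are tree bonds (`a = 0`), so a bond variable — a ladder of `h` loops —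
moves under translation by at most `h·p`: the (★) row is the curvature's translation modulus `p` times the ladder height. [cite: Balaban1985Averaging, (44)-(45) p.24, (46) p.25] -/
theorem dist1_hol_ladder_translate_le (V : Site d → Fin d → G) (s : Site d) (μ : Fin d) {a p : ℝ} (ha : 0 ≤ a) (hp : 0 ≤ p)
    (w : List (Letter d)) (x : Site d)
    (hstep : ∀ (w₁ : List (Letter d)) (l : Letter d) (w₂ : List (Letter d)), w = w₁ ++ l :: w₂ →
      dist1 (stepHol V (x + disp w₁) l * (stepHol V (x + disp w₁ + s) l)⁻¹) ≤ a)
    (hplaq : ∀ (w₁ : List (Letter d)) (l : Letter d) (w₂ : List (Letter d)), w = w₁ ++ l :: w₂ →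
      dist1 (hol V (x + disp w₁) (lplaqWord l μ) * (hol V (x + disp w₁ + s) (lplaqWord l μ))⁻¹) ≤ p) :
    dist1 (hol V x (ladder w μ) * (hol V (x + s) (ladder w μ))⁻¹) ≤ (w.length : ℝ) * (2 * a + p) := by
  rw [← hol_translate V s (ladder w μ) x]
  refine dist1_hol_ladder_mul_inv_le V (fun z ν => V (z + s) ν) μ ha hp w x (fun w₁ l w₂ hw => ?_) (fun w₁ l w₂ hw => ?_)
  · have h := hstep w₁ l w₂ hw
    have e1 : stepHol (fun z ν => V (z + s) ν) (x + disp w₁) l = stepHol V (x + disp w₁ + s) l := by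
      simp only [stepHol]
      split_ifs <;> simp [add_right_comm]
    rwa [e1]
  · have h := hplaq w₁ l w₂ hw
    rwa [hol_translate]

end Summit.QuantumFields.YangMills.Theorems.LadderHolonomyModulus
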